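/-
Copyright: cell `pub-ymgap` (HUMAN RULING D-0062), Track A of `YM-PLAN.md`, DAG node N20 (= NE7b); R134 acceleration seat
`pub-ymgap-dag-n20-c` (strategy s1, generation 10), module 51.  Released under the licence of the surrounding project.
-/
import Summits.QuantumFields.YangMills.Theorems.BalabanUVNodesN20LCSCanonicalRegion
import Summits.QuantumFields.YangMills.Theorems.BalabanUVNodesN20LCSLargeFieldSparsify
import Summits.QuantumFields.YangMills.Theorems.BalabanUVNodesN20LCSTorusCounting
import HarnessLib

/-!
# YM-DAG node N20 (= NE7b), row s1, module 51: THE SKELETON AND THE TWO COUNTS OF MODULE 49 §4 ARE THEOREMS — the greedy skeleton for ANY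
# pinned family of χ_{k+1}-cubes (`#D ≤ 39^d·#D′`), the size of a canonical region (`#R♮_k(c) ≤ d²·(9·L·M₂·R_{k+1})^d`), and the
# instance-modulo-two for ARBITRARY pinned families

Track A of `YM-PLAN.md` (cell `pub-ymgap`, HUMAN RULING D-0062), node **N20** = spine estimate NE7b (`T4WeightBudget.RelWeightBound`, NOT
PRINTED, NOT PROVED).  Seat `pub-ymgap-dag-n20-c` (R134, s1), generation 10, module 51 (imports module 49 `…N20LCSCanonicalRegion`, module 26
`…N20LCSLargeFieldSparsify` for the greedy `exists_disjoint_subfamily`, module 50 `…N20LCSTorusCounting`).  Kernel theorems only: 0 `def`, 0 `sorry`,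
standard axioms; COUNT-NEUTRAL.  Lattice combinatorics and bookkeeping; it asserts nothing of Bałaban's.

WHY.  Module 49 §4 (the instance at the record modulo (W) + (T♮) + (R)) still asked its CONSUMER for a skeleton: a sub-family `D′_j ⊆ D_j` of the pinned
cubes with pairwise disjoint canonical regions `R♮_j(c) = {p′ ∈ Plaq (j+1) | embIter (j+1) p′.src ∈ □_c^{∼4}}`, a density `#D_j ≤ K·#D′_j`, and a size
`#R♮_j(c) ≤ m` — displayed as the hypotheses `hsub ∕ hK ∕ hdisj ∕ hm` («counting not typed»).  THIS FILE types them, over module 50's torus counting: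
* §1 AT def-R's χ_{k+1}-CUBES (`0 < M₂`): `sideχ_pos_of_M₂_pos`, `corner_mem_cubeχ` (the corner `π(sideχ·c)` lies in `□_c`), `near_of_not_disjoint_canon`
  (canonical regions that meet have corners `< 10·sideχ` apart in EVERY coordinate — module 49 §1's `disjoint_canon_of_far`, contraposed),
  `card_filter_not_disjoint_canon_le` (at most `39^d` cubes of any family meet a given canonical region — module 50's seam-aware `card_filter_near_le`, no
  divisibility letter), ★★ **`exists_canon_skeleton`** — EVERY pinned family `D` has a skeleton `D′ ⊆ D` with pairwise disjoint canonical regions and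
  `#D ≤ 39^d·#D′` (module 26's greedy `exists_disjoint_subfamily` on the PROVED overlap count): the letters `hsub ∕ hK ∕ hdisj` are THEOREMS.
* §2 ★ **`card_canon_le`** — `#R♮_k(c) ≤ d²·(9·L·M₂·R_{k+1})^d` (`k + 1 ≤ m + K`): the `4`-collar `□_c^{∼4}` has side `9·sideχ k = (9·L·M₂·R_{k+1})·L^{k+1}`
  fine sites, so at most `(9·L·M₂·R_{k+1})^d` sites of `T^{(k+1)}` embed into it (module 50), each the source of `≤ d²` plaquettes: the letter `hm` is a THEOREM
  (level by level; the regime's single `m` must dominate these sizes at the pinned levels — the arithmetic side condition `hmJ` of §3).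
* §3 `hLSw_of_window` and ★★★ **`sum_admS_integral_le_rec_pinnedLevels_in_regime_canon_of_any`** — module 49 §4 FOR ARBITRARY PINNED FAMILIES `D_j`:
  the binders `D′ hsub hK hdisj hm` are GONE (`K := 39^d`; `hm ↦ hmJ : ∀ j ∈ J, d²·(9·L·M₂·R_{j+1})^d ≤ m`), MODULO (W♮) «LCS-j ON THE HULL OF THE (3.2)
  WINDOW's CANONICAL REGIONS» — the family-free form of (W): the hull is taken over ALL window cubes `c ∈ cubes32 j (seqOfHist j h)` instead of over a
  pinned family inside the window; it implies module 48 ∕ 49's `hLSw` for EVERY window-contained family (`hLSw_of_window`: a hull over fewer cubes is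
  smaller), it is what a proof of (A1c) would give (the estimate never reads WHICH cubes are pinned, only where `X` sits relative to the history's
  small-field regions), and module 42 §5's `disjoint_hull_labelAt` (stated for every `D ⊆ cubes32`, in particular `D := cubes32`) certifies it immune to
  module 38's forcing —, (T♮) at EVERY cube (module 49 §3's all-minimisers shape, now simply `∀ c`), and the regime (R) of module 48 §2.

HONEST FRAMING.  Counting and bookkeeping; no estimate of Bałaban's.  (W♮) ((A1c), THE wall, NOT PRINTED as a statement; print's KIND:
[Balaban1989LargeFieldI] (0.3)–(0.5) pp.176–177) and (T♮) ([Balaban1985Variational] Thm 1 (9) for the LOCAL (2.16) problems of record — K0's pen; the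
tree's Theorem-1 socket `B11Thm1CarrierT.varProblemT` is the no-holes global problem) stay DISPLAYED; the regime's `m`, `M ≫ M₂` (module 43) and the run's
couplings `0 < g_{j+1} ≤ γ` stay displayed numerics.  The constant `39^d` is crude (print's geometry gives `≈ 20^d`); only its finiteness matters for the
rate `κ∕39^d`.  NE7b NOT PRINTED ∕ NOT PROVED; (α)-instance 0∕1; N20 NOT discharged; typed 28∕28, count untouched; one finite four-torus at fixed `ε` —
NOT ℝ⁴, NOT infinite volume, NOT OS, NOT a mass gap, NOT Clay.

References (LOCATORS): T. Bałaban, CMP 119 (1988) 243–285 [Balaban1988Convergent] ((2.16)–(2.17) p.257, (3.2) p.265, p.264–265 (the layer calculus));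
CMP 109 (1987) 249–301 [Balaban1987RG1] ((0.1) p.251–252); CMP 122 (1989) 355–392 [Balaban1989LargeFieldII] ((1.79)–(1.80) pp.383–384: one small factor
per large-field cube, up to geometric constants); CMP 122 (1989) 175–202 [Balaban1989LargeFieldI] ((0.3)–(0.5) pp.176–177); CMP 102 (1985) 277–309
[Balaban1985Variational] (Thm 1 (9) p.279).
-/

set_option autoImplicit false

noncomputable section

open scoped BigOperators ENNReal

namespace Summit.QuantumFields.YangMills.BalabanUVNodes.N20LCSCanonicalSkeleton

open MeasureTheory
open Literature.MathematicalPhysics.QuantumFieldTheory.Balaban1983to89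
open Literature.MathematicalPhysics.QuantumFieldTheory.Balaban1983to89.T4Continuum
open Literature.MathematicalPhysics.QuantumFieldTheory.Balaban1983to89.B14.Eq218Concrete
open Literature.MathematicalPhysics.QuantumFieldTheory.Balaban1983to89.Node00
open B15DeterminingSets B14.Eq213DetSet B14.Eq216Concrete B14.Eq213MaximalDomains B15Eq112TorusCover B14DomainGeom
open Literature.MathematicalPhysics.QuantumFieldTheory.BalabanImbrieJaffe1984to88.BIJ85Eq453GaugeField (qsstarGIter0)
open ExpMeanLog (deltaSU)
open Summit.QuantumFields.BalabanUV.T4Continuum.B16HistoryIndexedRepr (GoodClass)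
open Summit.QuantumFields.BalabanUV.T4Continuum.B16HistoryReprChain
open Summit.QuantumFields.BalabanUV.T4Continuum.NE7b.PrefixExtraction (admS)
open Summit.QuantumFields.YangMills.BalabanUVNodes.N20LCSLabelTower
open Summit.QuantumFields.YangMills.BalabanUVNodes.N20LCSAvgDominationRegion (boxRegion)
open Literature.MathematicalPhysics.QuantumFieldTheory.Balaban1983to89.B15Claim189LambdaPin (coordDist)
open Literature.MathematicalPhysics.QuantumFieldTheory.Balaban1983to89.B14SeparationOfRecord (one_le_RkOfRecord)
open Summit.QuantumFields.YangMills.BalabanUVNodes.N20LCSLargeFieldSparsify (exists_disjoint_subfamily)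
open Summit.QuantumFields.YangMills.BalabanUVNodes.N20LCSTorusCounting (card_filter_near_le card_filter_embIter_mem_cubeEnl_le card_filter_plaq_le)
open Summit.QuantumFields.YangMills.BalabanUVNodes.N20LCSCanonicalRegion (disjoint_canon_of_far sum_admS_integral_le_rec_pinnedLevels_in_regime_canon)

/-! ## §1 At def-R's χ_{k+1}-cubes: corners, nearness of meeting canonical regions, the skeleton for ANY pinned family -/

section Cubes

variable (F : T4Family) (ν : Stage7Numerics) (p : B12.RunParams) (g : ℕ → ℝ) (k : ℕ)

/-- The side of the χ_{k+1}-cubes is positive once `0 < M₂` (`0 < L`, `1 ≤ R_{k+1}`). [cite: Balaban1988Convergent, (2.17) p.257 (bookkeeping)] -/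
theorem sideχ_pos_of_M₂_pos (hM₂ : 0 < ν.M₂) : 0 < sideχ F ν p g k := by
  unfold sideχ cubeSide
  exact Nat.mul_pos (Nat.mul_pos (pow_pos (F.P p.K).L_pos _) hM₂) (one_le_RkOfRecord (F.P p.K).L_pos _ _)

/-- **THE CORNER OF A χ_{k+1}-CUBE LIES IN IT**: `π(sideχ·c) ∈ □_c` (`0 < M₂`). [cite: Balaban1988Convergent, (2.17) p.257 (bookkeeping)] -/
theorem corner_mem_cubeχ (hM₂ : 0 < ν.M₂) (c : Iχ F ν p g k) :
    cover (F.P p.K) (fun i => (sideχ F ν p g k : ℤ) * (c : Pt (F.P p.K).d) i) ∈ cubeEnl (F.P p.K) (sideχ F ν p g k) c 0 := by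
  have hs := sideχ_pos_of_M₂_pos F ν p g k hM₂
  refine ⟨fun i => (sideχ F ν p g k : ℤ) * (c : Pt (F.P p.K).d) i, fun i => ⟨?_, ?_⟩, rfl⟩
  · simp
  · have : (1 : ℤ) ≤ sideχ F ν p g k := by exact_mod_cast hs
    push_cast
    linarith

open Classical in
/-- **CANONICAL REGIONS THAT MEET HAVE NEAR CORNERS**: if `R♮_k(c₁)` and `R♮_k(c₂)` are not disjoint, the corners of `□_{c₁}`, `□_{c₂}` are `< 10·sideχ k`
apart in EVERY coordinate (module 49 §1 `disjoint_canon_of_far`, contraposed at the corners). [cite: Balaban1988Convergent, (2.16)–(2.17) p.257, p.264–265] -/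
theorem near_of_not_disjoint_canon (hM₂ : 0 < ν.M₂) {c₁ c₂ : Iχ F ν p g k}
    (h : ¬ Disjoint
      (Finset.univ.filter fun q : Plaq (F.P p.K) (k + 1) => embIter (k + 1) q.src ∈ cubeEnl (F.P p.K) (sideχ F ν p g k) c₁ 4)
      (Finset.univ.filter fun q : Plaq (F.P p.K) (k + 1) => embIter (k + 1) q.src ∈ cubeEnl (F.P p.K) (sideχ F ν p g k) c₂ 4)) :
    ∀ i, coordDist (cover (F.P p.K) fun j => (sideχ F ν p g k : ℤ) * (c₁ : Pt (F.P p.K).d) j)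
      (cover (F.P p.K) fun j => (sideχ F ν p g k : ℤ) * (c₂ : Pt (F.P p.K).d) j) i < 10 * sideχ F ν p g k := by
  by_contra hfar
  push Not at hfar
  exact h (disjoint_canon_of_far F ν p g k (corner_mem_cubeχ F ν p g k hM₂ c₁) (corner_mem_cubeχ F ν p g k hM₂ c₂) hfar)

open Classical in
/-- **AT MOST `39^d` CUBES OF ANY FAMILY MEET A GIVEN CANONICAL REGION** (module 50's `card_filter_near_le` through `near_of_not_disjoint_canon`).
[cite: Balaban1989LargeFieldII, (1.79)–(1.80) pp.383–384 (geometric constants); Balaban1988Convergent, (2.17) p.257] -/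
theorem card_filter_not_disjoint_canon_le (hM₂ : 0 < ν.M₂) (D : Finset (Iχ F ν p g k)) (c : Iχ F ν p g k) :
    (D.filter fun c' : Iχ F ν p g k => ¬ Disjoint
      (Finset.univ.filter fun q : Plaq (F.P p.K) (k + 1) => embIter (k + 1) q.src ∈ cubeEnl (F.P p.K) (sideχ F ν p g k) c 4)
      (Finset.univ.filter fun q : Plaq (F.P p.K) (k + 1) => embIter (k + 1) q.src ∈ cubeEnl (F.P p.K) (sideχ F ν p g k) c' 4)).card ≤
      39 ^ (F.P p.K).d := by
  have hs := sideχ_pos_of_M₂_pos F ν p g k hM₂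
  refine le_trans ?_ (card_filter_near_le (P := F.P p.K) hs c.2)
  refine Finset.card_le_card_of_injOn (fun c' : Iχ F ν p g k => (c' : Pt (F.P p.K).d)) (fun c' hc' => ?_)
    (fun c₁ _ c₂ _ h => Subtype.ext h)
  have hc'' := (Finset.mem_filter.1 (Finset.mem_coe.1 hc')).2
  rw [Finset.mem_coe, Finset.mem_filter]
  exact ⟨c'.2, near_of_not_disjoint_canon F ν p g k hM₂ hc''⟩

open Classical in
/-- ★★ **EVERY PINNED FAMILY HAS A SKELETON**: for any family `D` of χ_{k+1}-cubes there is `D′ ⊆ D` whose canonical regions are pairwise disjoint and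
`#D ≤ 39^d·#D′` — module 26's greedy `exists_disjoint_subfamily` on the proved overlap count; the skeleton letters `hsub ∕ hK ∕ hdisj` of module 48 §3 ∕
49 §4 are THEOREMS. [cite: Balaban1989LargeFieldII, (1.79)–(1.80) pp.383–384 (the sparse sub-lattice of large-field cubes)] -/
theorem exists_canon_skeleton (hM₂ : 0 < ν.M₂) (D : Finset (Iχ F ν p g k)) :
    ∃ D' : Finset (Iχ F ν p g k), D' ⊆ D ∧
      (∀ c₁ ∈ D', ∀ c₂ ∈ D', c₁ ≠ c₂ → Disjoint
        (Finset.univ.filter fun q : Plaq (F.P p.K) (k + 1) => embIter (k + 1) q.src ∈ cubeEnl (F.P p.K) (sideχ F ν p g k) c₁ 4)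
        (Finset.univ.filter fun q : Plaq (F.P p.K) (k + 1) => embIter (k + 1) q.src ∈ cubeEnl (F.P p.K) (sideχ F ν p g k) c₂ 4)) ∧
      D.card ≤ 39 ^ (F.P p.K).d * D'.card :=
  exists_disjoint_subfamily
    (fun c : Iχ F ν p g k =>
      Finset.univ.filter fun q : Plaq (F.P p.K) (k + 1) => embIter (k + 1) q.src ∈ cubeEnl (F.P p.K) (sideχ F ν p g k) c 4)
    (Nat.one_le_pow _ _ (by norm_num)) D fun c _ => card_filter_not_disjoint_canon_le F ν p g k hM₂ D c

end Cubes

/-! ## §2 The size of a canonical region -/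

section Size

variable (F : T4Family) (ν : Stage7Numerics) (p : B12.RunParams) (g : ℕ → ℝ) (k : ℕ)

open Classical in
/-- ★ **THE SIZE OF THE CANONICAL REGION**: `#R♮_k(c) ≤ d²·(9·L·M₂·R_{k+1})^d` for `k + 1 ≤ m + K` — the `4`-collar `□_c^{∼4}` has side `9·sideχ k =
(9·L·M₂·R_{k+1})·L^{k+1}` fine sites (`sideχ k = L^{k+2}M₂R_{k+1}`), so at most `(9·L·M₂·R_{k+1})^d` sites of `T^{(k+1)}` embed into it (module 50), each the source
of `≤ d²` plaquettes; the size letter `hm` of module 48 §3 ∕ 49 §4 is a THEOREM. [cite: Balaban1988Convergent, (2.16)–(2.17) p.257; Balaban1987RG1, (0.1) p.251–252] -/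
theorem card_canon_le (hk : k + 1 ≤ (F.P p.K).m + (F.P p.K).K) (c : Iχ F ν p g k) :
    (Finset.univ.filter fun q : Plaq (F.P p.K) (k + 1) => embIter (k + 1) q.src ∈ cubeEnl (F.P p.K) (sideχ F ν p g k) c 4).card ≤
      (F.P p.K).d ^ 2 * (9 * ((F.P p.K).L * ν.M₂ * RkOfRecord (F.P p.K).L ν.r (g (k + 1)))) ^ (F.P p.K).d := by
  have hℓ : (2 * 4 + 1) * sideχ F ν p g k =
      (9 * ((F.P p.K).L * ν.M₂ * RkOfRecord (F.P p.K).L ν.r (g (k + 1)))) * (F.P p.K).L ^ (k + 1) := by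
    unfold sideχ cubeSide; ring
  exact (card_filter_plaq_le (P := F.P p.K)
      (fun x : Site (F.P p.K) (k + 1) => embIter (k + 1) x ∈ cubeEnl (F.P p.K) (sideχ F ν p g k) c 4)).trans
    (Nat.mul_le_mul_left _ (card_filter_embIter_mem_cubeEnl_le (P := F.P p.K) hk hℓ _))

end Size

/-! ## §3 The instance modulo two for ARBITRARY pinned families (module 49 §4 with the skeleton and the counts discharged) -/

section OfAny

variable (F : T4Family) (N : ℕ) [NeZero N] (ν : Stage7Numerics) (M : ℕ) (p : B12.RunParams) (g : ℕ → ℝ) (A₁ : ℝ)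

open Classical in
/-- **(W♮) ⇒ (W) FOR EVERY WINDOW-CONTAINED FAMILY**: «LCS-j on the hull of the (3.2) WINDOW's canonical regions» (hull over ALL `c ∈ cubes32 j (seqOfHist j h)`)
implies module 48 §2 ∕ §3 ∕ 49 §4's `hLSw` for every family `D′_j ⊆ cubes32 j (seqOfHist j h)` (a hull over fewer cubes is smaller).
[cite: Balaban1989LargeFieldI, (0.3)–(0.5) pp.176–177; Balaban1988Convergent, (3.2) p.265] -/
theorem hLSw_of_window {K' : ℕ} {J : Finset ℕ} {a₀ C : ℝ} {ρ₀ : cfgOfRecord F N p.K 0 → ℝ}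
    (E : (j : ℕ) → (Fin j → LabelPat F ν p g) → Finset (LbOfRecord F ν p g j)) (D' : (j : ℕ) → Finset (Iχ F ν p g j))
    (hW : ∀ j ∈ J, j < K' → ∀ h : Fin j → LabelPat F ν p g,
      h ∈ admS (labelTowerOfRecord F N ν M p g A₁ (zeta316OfRecord F N ν M A₁)) (labelPattern F ν p g E) j →
      ∀ a : ℝ, 0 ≤ a → a ≤ a₀ → ∀ X : Finset (Plaq (F.P p.K) j),
        (∀ q ∈ X, ∃ c ∈ cubes32 F ν M p g j (seqOfHist F ν M p g j h),
          ∃ p' ∈ (Finset.univ.filter fun q : Plaq (F.P p.K) (j + 1) => embIter (j + 1) q.src ∈ cubeEnl (F.P p.K) (sideχ F ν p g j) c 4),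
            q ∈ boxRegion (emb p'.src) (((F.P p.K).d + 3) * (F.P p.K).L + 2)) →
        ∫ U, Real.exp (a * ((g (j + 1)) ^ 2)⁻¹ * ∑ q ∈ X, (1 - reTr (GaugeField.plaqHol U q))) *
            (labelTowerOfRecord F N ν M p g A₁ (zeta316OfRecord F N ν M A₁)).eterm ρ₀ j h U ∂(lawOfRecord F N p.K j) ≤
          Real.exp (C * a * X.card) * ∫ U, (labelTowerOfRecord F N ν M p g A₁ (zeta316OfRecord F N ν M A₁)).eterm ρ₀ j h U ∂(lawOfRecord F N p.K j)) :
    ∀ j ∈ J, j < K' → ∀ h : Fin j → LabelPat F ν p g,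
      h ∈ admS (labelTowerOfRecord F N ν M p g A₁ (zeta316OfRecord F N ν M A₁)) (labelPattern F ν p g E) j →
      D' j ⊆ cubes32 F ν M p g j (seqOfHist F ν M p g j h) →
      ∀ a : ℝ, 0 ≤ a → a ≤ a₀ → ∀ X : Finset (Plaq (F.P p.K) j),
        (∀ q ∈ X, ∃ c ∈ D' j,
          ∃ p' ∈ (Finset.univ.filter fun q : Plaq (F.P p.K) (j + 1) => embIter (j + 1) q.src ∈ cubeEnl (F.P p.K) (sideχ F ν p g j) c 4),
            q ∈ boxRegion (emb p'.src) (((F.P p.K).d + 3) * (F.P p.K).L + 2)) →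
        ∫ U, Real.exp (a * ((g (j + 1)) ^ 2)⁻¹ * ∑ q ∈ X, (1 - reTr (GaugeField.plaqHol U q))) *
            (labelTowerOfRecord F N ν M p g A₁ (zeta316OfRecord F N ν M A₁)).eterm ρ₀ j h U ∂(lawOfRecord F N p.K j) ≤
          Real.exp (C * a * X.card) * ∫ U, (labelTowerOfRecord F N ν M p g A₁ (zeta316OfRecord F N ν M A₁)).eterm ρ₀ j h U ∂(lawOfRecord F N p.K j) :=
  fun j hj hjK h hadm hwin a ha0 ha X hX =>
    hW j hj hjK h hadm a ha0 ha X fun q hq => by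
      obtain ⟨c, hc, p', hp', hq'⟩ := hX q hq
      exact ⟨c, hwin hc, p', hp', hq'⟩

open Classical in
/-- ★★★ **THE INSTANCE AT THE RECORD MODULO (W♮) + (T♮) + (R), FOR ARBITRARY PINNED FAMILIES — NO SKELETON, NO COUNT, NO REGION LEFT TO THE CONSUMER.**
Module 49 §4 with `D′ := ` the skeleton of §1 (`exists_canon_skeleton`, `K = 39^d`) and the size `#R♮_j(c) ≤ d²(9LM₂R_{j+1})^d ≤ m` of §2: for ANY pinned
families `D_j` (levels `j ∈ J`, `j < K`), IF (W♮) «LCS-j on the hull of the (3.2) window's canonical regions for window-admissible prefixes» with level-uniform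
`C` and (T♮) «every minimiser of the (2.16) problem of record at a χ_{j+1}-cube `c` whose datum is `ε(g_{j+1})∕B`-small on `R♮_j(c)` is `ε_{j+1}η²`-small on
`{p ⊂ □_c^∼}`» at every cube, THEN in the regime `0 < g_{j+1} ≤ γ`, `(X∕A₀²)^{1∕(2p₀)} ≤ log γ⁻²`, `d²(9LM₂R_{j+1})^d ≤ m`:
`Σ_{h ∈ class K′} ∫ eterm ρ₀ K′ h dμ_{K′} ≤ exp(−(δ·(C·A·M_h² + log m∕δ))∕39^d · Σ_{j<K′, j∈J} #D_j)·∫ρ₀ dU₀` — ONE level-uniform Peierls factor per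
`39^d` pinned cubes. [cite: Balaban1989LargeFieldII, (1.79)–(1.80) pp.383–384; Balaban1985Variational, Thm 1 (9) p.279; Balaban1988Convergent, (2.16)–(2.17) p.257, (3.2) p.265] -/
theorem sum_admS_integral_le_rec_pinnedLevels_in_regime_canon_of_any {ρ₀ : cfgOfRecord F N p.K 0 → ℝ}
    (hρ : (bddMeas (cfgOfRecord F N p.K 0)).Gd ρ₀) (h0 : ∀ U, 0 ≤ ρ₀ U) (hM₂ : 0 < ν.M₂)
    (J : Finset ℕ) (hJ : ∀ j ∈ J, j < p.K)
    (D : (j : ℕ) → Finset (Iχ F ν p g j)) (m : ℕ) (hm1 : 1 ≤ m)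
    (hmJ : ∀ j ∈ J, (F.P p.K).d ^ 2 * (9 * ((F.P p.K).L * ν.M₂ * RkOfRecord (F.P p.K).L ν.r (g (j + 1)))) ^ (F.P p.K).d ≤ m)
    {B γ : ℝ} (hB : 0 < B) (hA0 : 0 < ν.A₀) (hp0 : 1 ≤ ν.p₀)
    (hg : ∀ j ∈ J, 0 < g (j + 1) ∧ g (j + 1) ≤ γ)
    (hεη : ∀ j ∈ J, 0 < epsOfRecord ν g (j + 1) * (F.P p.K).eta (j + 1) ^ 2)
    (hThm1 : ∀ j ∈ J, ∀ (c : Iχ F ν p g j) (V' : GaugeField (F.P p.K) (j + 1) (SU N)) (U₀ : GaugeField (F.P p.K) 0 (SU N)),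
      IsMinimizer (avOfRecord F N p.K) {U | PlaqSmall (ν.εreg * (F.P p.K).eta (j + 1) ^ 2) U}
          (Bj ν.M₁ (cubeEnl (F.P p.K) (sideχ F ν p g j) c 4) (j + 1)) (avgFamily (avOfRecord F N p.K) (qsstarGIter0 (j + 1) V')) U₀ →
      (∀ p' : Plaq (F.P p.K) (j + 1), embIter (j + 1) p'.src ∈ cubeEnl (F.P p.K) (sideχ F ν p g j) c 4 →
        dist1 (GaugeField.plaqHol V' p') < epsOfRecord ν g (j + 1) / B) →
      PlaqSmallOn (plaqInside (cubeEnl (F.P p.K) (sideχ F ν p g j) c 1)) (epsOfRecord ν g (j + 1) * (F.P p.K).eta (j + 1) ^ 2) U₀)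
    {α C a₀ δ : ℝ} (hα : 0 < α)
    (hguard : (((((F.P p.K).d + 2) * (F.P p.K).L : ℕ) : ℝ) ^ 2 / 4) * Real.sqrt (2 * (Fintype.card (Fin N) : ℝ) * α) < deltaSU (Fin N))
    (hC : 0 ≤ C) (hδ : 0 < δ)
    (hδa : δ * ((2 * (Fintype.card (Fin N) : ℝ) * (((F.P p.K).L : ℝ) ^ 2 + 6 * ((((F.P p.K).d + 2) * (F.P p.K).L : ℕ) : ℝ) ^ 2) ^ 2 +
        2 / α) * (((2 * (((F.P p.K).d + 3) * (F.P p.K).L + 2) + 1) ^ (F.P p.K).d * (F.P p.K).d ^ 2 : ℕ) : ℝ)) ≤ a₀)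
    (hX : 0 ≤ 4 * (Fintype.card (Fin N) : ℝ) * B ^ 2 *
      (C * ((2 * (Fintype.card (Fin N) : ℝ) * (((F.P p.K).L : ℝ) ^ 2 + 6 * ((((F.P p.K).d + 2) * (F.P p.K).L : ℕ) : ℝ) ^ 2) ^ 2 + 2 / α) *
          (((2 * (((F.P p.K).d + 3) * (F.P p.K).L + 2) + 1) ^ (F.P p.K).d * (F.P p.K).d ^ 2 : ℕ) : ℝ)) *
          (((2 * (((F.P p.K).d + 3) * (F.P p.K).L + 2) + 1) ^ (F.P p.K).d * (F.P p.K).d ^ 2 : ℕ) : ℝ) + Real.log m / δ))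
    (hlog : (4 * (Fintype.card (Fin N) : ℝ) * B ^ 2 *
      (C * ((2 * (Fintype.card (Fin N) : ℝ) * (((F.P p.K).L : ℝ) ^ 2 + 6 * ((((F.P p.K).d + 2) * (F.P p.K).L : ℕ) : ℝ) ^ 2) ^ 2 + 2 / α) *
          (((2 * (((F.P p.K).d + 3) * (F.P p.K).L + 2) + 1) ^ (F.P p.K).d * (F.P p.K).d ^ 2 : ℕ) : ℝ)) *
          (((2 * (((F.P p.K).d + 3) * (F.P p.K).L + 2) + 1) ^ (F.P p.K).d * (F.P p.K).d ^ 2 : ℕ) : ℝ) + Real.log m / δ) / ν.A₀ ^ 2) ^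
        ((1 : ℝ) / (2 * ν.p₀)) ≤ Real.log (γ ^ 2)⁻¹)
    (K' : ℕ) (E : (j : ℕ) → (Fin j → LabelPat F ν p g) → Finset (LbOfRecord F ν p g j)) (hE : ∀ j ∈ J, ∀ h t, t ∈ E j h → D j ⊆ t.1)
    (hW : ∀ j ∈ J, j < K' → ∀ h : Fin j → LabelPat F ν p g,
      h ∈ admS (labelTowerOfRecord F N ν M p g A₁ (zeta316OfRecord F N ν M A₁)) (labelPattern F ν p g E) j →
      ∀ a : ℝ, 0 ≤ a → a ≤ a₀ → ∀ X : Finset (Plaq (F.P p.K) j),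
        (∀ q ∈ X, ∃ c ∈ cubes32 F ν M p g j (seqOfHist F ν M p g j h),
          ∃ p' ∈ (Finset.univ.filter fun q : Plaq (F.P p.K) (j + 1) => embIter (j + 1) q.src ∈ cubeEnl (F.P p.K) (sideχ F ν p g j) c 4),
            q ∈ boxRegion (emb p'.src) (((F.P p.K).d + 3) * (F.P p.K).L + 2)) →
        ∫ U, Real.exp (a * ((g (j + 1)) ^ 2)⁻¹ * ∑ q ∈ X, (1 - reTr (GaugeField.plaqHol U q))) *
            (labelTowerOfRecord F N ν M p g A₁ (zeta316OfRecord F N ν M A₁)).eterm ρ₀ j h U ∂(lawOfRecord F N p.K j) ≤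
          Real.exp (C * a * X.card) * ∫ U, (labelTowerOfRecord F N ν M p g A₁ (zeta316OfRecord F N ν M A₁)).eterm ρ₀ j h U ∂(lawOfRecord F N p.K j)) :
    ∑ h ∈ admS (labelTowerOfRecord F N ν M p g A₁ (zeta316OfRecord F N ν M A₁)) (labelPattern F ν p g E) K',
        ∫ x, (labelTowerOfRecord F N ν M p g A₁ (zeta316OfRecord F N ν M A₁)).eterm ρ₀ K' h x ∂(lawOfRecord F N p.K K') ≤
      Real.exp (-(δ * (C * ((2 * (Fintype.card (Fin N) : ℝ) * (((F.P p.K).L : ℝ) ^ 2 + 6 * ((((F.P p.K).d + 2) * (F.P p.K).L : ℕ) : ℝ) ^ 2) ^ 2 +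
              2 / α) * (((2 * (((F.P p.K).d + 3) * (F.P p.K).L + 2) + 1) ^ (F.P p.K).d * (F.P p.K).d ^ 2 : ℕ) : ℝ)) *
              (((2 * (((F.P p.K).d + 3) * (F.P p.K).L + 2) + 1) ^ (F.P p.K).d * (F.P p.K).d ^ 2 : ℕ) : ℝ) + Real.log m / δ)) / (39 : ℝ) ^ (F.P p.K).d *
          ∑ j ∈ (Finset.range K').filter (· ∈ J), ((D j).card : ℝ)) *
        ∫ U, ρ₀ U ∂(fieldMeasure (F.P p.K) 0 (SU N)) := by
  -- the skeleton, level by level (§1)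
  have hsk := fun j => exists_canon_skeleton F ν p g j hM₂ (D j)
  choose D' hsub hdisj hK using hsk
  -- the size of the canonical regions (§2) in the standing range `j + 1 ≤ m + K`
  have hm : ∀ j ∈ J, ∀ c ∈ D' j,
      (Finset.univ.filter fun q : Plaq (F.P p.K) (j + 1) =>
        embIter (j + 1) q.src ∈ cubeEnl (F.P p.K) (sideχ F ν p g j) c 4).card ≤ m := by
    intro j hj c _
    have hjK : j + 1 ≤ (F.P p.K).m + (F.P p.K).K := by
      have := hJ j hj; rw [T4Family.P_K]; omega
    exact (card_canon_le F ν p g j hjK c).trans (hmJ j hj)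
  have h := sum_admS_integral_le_rec_pinnedLevels_in_regime_canon F N ν M p g A₁ hρ h0 J hJ D D' (fun j _ => hsub j)
    (K := 39 ^ (F.P p.K).d) (Nat.one_le_pow _ _ (by norm_num)) (fun j _ => hK j) m hm1 hm
    (fun j _ c₁ hc₁ c₂ hc₂ hne => hdisj j c₁ hc₁ c₂ hc₂ hne) hB hA0 hp0 hg hεη (fun j hj c _ => hThm1 j hj c)
    hα hguard hC hδ hδa hX hlog K' E hE (hLSw_of_window F N ν M p g A₁ E D' hW)
  have hcast : ((39 ^ (F.P p.K).d : ℕ) : ℝ) = (39 : ℝ) ^ (F.P p.K).d := by push_cast; rfl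
  rw [hcast] at h
  exact h

end OfAny

end Summit.QuantumFields.YangMills.BalabanUVNodes.N20LCSCanonicalSkeleton

end
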